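import Summits.CriticalPhenomena.PercolationContinuityZ3.Theorems.SubpolynomialBlocking.Negative.OffCritical
import Literature.Probability.Percolation.UniformPercolation
import Literature.Probability.Percolation.CorrelationLengthDKTProofs
import Literature.Probability.Percolation.FiniteEnergy

/-!
# `SubpolynomialBlocking` — negative knowledge III: jump world, refuted strengthenings, the known floor

Support file for crux item stmt-CriticalPhenomena-4446 (`PercNonProliferation.SubpolynomialBlocking`), written by
the crux's standing disprover (Cruxes/SubpolynomialBlocking/Disproof.lean, §5–§7). With the vocabulary of
`Negative/OffCritical.lean` (`blockProb d p n = u_n(d,p)`; the crux is `∀ s > 0, ∀ᶠ n, n^{-s} ≤ u_n(3, p_c)`):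

* `tendsto_blockProb_zero_of_theta_pos` — if `θ(p) > 0` then `u_n(d,p) → 0` (uniform percolation from large
  sets, in tree): in the jump world `θ(p_c) > 0` the crux is a pure RATE statement, so the jump world alone does
  not refute it;
* `blockProb_lt_one`, `blockProb_criticalProb_three_lt_one` — `u_n < 1` (a critical arm has positive probability);
* REFUTED NATURAL STRENGTHENINGS of the crux at `p_c(ℤ³)`: `not_uniform_in_s` (the eventuality cannot be uniform
  in `s`), `not_exponent_zero` (the endpoint `s = 0`, i.e. `u_n ≥ 1` eventually), `not_forall_n` ("for all `n ≥ 1`"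
  instead of eventually);
* THE KNOWN FLOOR: `pow_card_edgeBoundary_le_blockProb` — `(1-p)^{|∂_E Λ_n|} ≤ u_n` for `n ≥ 1` (all boundary edges
  closed), i.e. `u_n ≥ e^{-Cn²}` on `ℤ³`, and `blockProb_criticalProb_three_pos`; nothing between `e^{-Cn²}` and the
  crux's `n^{-s}` is in print for `d = 3`.
-/

noncomputable section

namespace Summit.CriticalPhenomena.PercolationContinuityZ3.Theorems.SubpolynomialBlocking.Negative

open MeasureTheory Filter Topology
open Literature.Probability.Percolation Literature.Probability.LatticeModels
open Literature.Barriers.CriticalPhenomena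
open Literature.Probability.Percolation.DCT16
open Summit.CriticalPhenomena.PercolationContinuityZ3.Theses

/-! ## §5 The jump world: `θ(p) > 0` forces `u_n → 0` (the crux is then a pure rate statement) -/

/-- `{some vertex of S percolates}` is measurable. -/
theorem measurableSet_exists_percolatesAt {d : ℕ} (S : Finset (Site d)) :
    MeasurableSet {ω : BondConfig (Site d) | ∃ y ∈ S, ω ∈ percolatesAt y} := by
  have : {ω : BondConfig (Site d) | ∃ y ∈ S, ω ∈ percolatesAt y} = ⋃ y ∈ S, percolatesAt y := by
    ext ω; simp only [Set.mem_setOf_eq, Set.mem_iUnion, exists_prop]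
  rw [this]
  exact Finset.measurableSet_biUnion _ fun y _ => measurableSet_percolatesAt_holds y

/-- Blocking forces "no vertex of `Λ_n` percolates" (a.s.): `u_n ≤ 1 - P(Λ_n ↔ ∞)`. -/
theorem blockProb_le_one_sub_real_exists_percolatesAt (d : ℕ) (p : unitInterval) (n : ℕ) :
    blockProb d p n ≤
      1 - (bondPercolation (zdGraph d) p).real {ω | ∃ y ∈ box d n, ω ∈ percolatesAt y} := by
  rw [← probReal_compl_eq_one_sub (measurableSet_exists_percolatesAt (box d n))]
  exact real_mono_of_forall_subset_edgeSet (zdGraph d) p fun ω hω hb =>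
    fun ⟨y, hy, hperc⟩ => hb (mem_annulusCrossing_of_percolatesAt hω hy hperc)

/-- **In the jump world the blocking probability tends to zero**: if `θ(p) > 0` on `ℤ^d`
(`d ≥ 1`) then `u_n(d,p) → 0` (uniform percolation from large sets,
`exists_card_le_imp_lt_real_exists_percolatesAt`, in tree). At `p = p_c(ℤ³)` with `θ(p_c) > 0`
the crux therefore asserts only that this convergence is slower than every power — consistent,
so the jump world does not refute the crux by itself. -/
theorem tendsto_blockProb_zero_of_theta_pos {d : ℕ} (hd : 1 ≤ d) (p : unitInterval)
    (hθ : 0 < theta (zdGraph d) (0 : Site d) p) :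
    Tendsto (fun n : ℕ => blockProb d p n) atTop (𝓝 0) := by
  rw [Metric.tendsto_atTop]
  intro ε hε
  obtain ⟨m₀, hm₀⟩ := exists_card_le_imp_lt_real_exists_percolatesAt p hθ hε
  refine ⟨m₀, fun n hn => ?_⟩
  rw [Real.dist_eq, sub_zero, abs_of_nonneg (blockProb_nonneg d p n)]
  have hcard : m₀ ≤ (box d n).card := by
    rw [card_box]
    calc m₀ ≤ n := hn
      _ ≤ 2 * n + 1 := by omega
      _ = (2 * n + 1) ^ 1 := (pow_one _).symm
      _ ≤ (2 * n + 1) ^ d := Nat.pow_le_pow_right (by omega) hd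
  have h := hm₀ (box d n) hcard
  linarith [blockProb_le_one_sub_real_exists_percolatesAt d p n]

/-! ## §6 Refuted natural strengthenings at `p_c(ℤ³)` -/

/-- A critical one-arm from the origin to `∂Λ_{2n}` crosses the annulus. -/
theorem real_siteToBoundary_le_real_annulusCrossing (d : ℕ) (p : unitInterval) (n : ℕ) :
    (bondPercolation (zdGraph d) p).real (siteToBoundary d (2 * n)) ≤
      (bondPercolation (zdGraph d) p).real (annulusCrossing d n) :=
  measureReal_mono fun ω h => ⟨0, zero_mem_box d n, h⟩

/-- `u_n < 1` for every `n`, every `d ≥ 1` and every `p > 0`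
(`u_n ≤ 1 - P_p(0 ↔ ∂Λ_{2n}) ≤ 1 - p^{2n}`). -/
theorem blockProb_lt_one {d : ℕ} (hd : 1 ≤ d) (p : unitInterval) (hp : 0 < (p : ℝ)) (n : ℕ) :
    blockProb d p n < 1 := by
  rw [blockProb_eq]
  have := DKT20.real_siteToBoundary_pos hd p hp (2 * n)
  linarith [real_siteToBoundary_le_real_annulusCrossing d p n]

/-- In particular at `p_c(ℤ³) > 0`. -/
theorem blockProb_criticalProb_three_lt_one (n : ℕ) : blockProb 3 (criticalProbI 3) n < 1 :=
  blockProb_lt_one (by norm_num) _ (criticalProb_zd_pos 3 (by norm_num)) n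

/-- **Refuted strengthening 1 (quantifier order)**: the eventuality cannot be uniform in `s`
(`∃ N ∀ s ∀ n ≥ N` is FALSE): `sup_{s>0} n^{-s} = 1 > u_n`. -/
theorem not_uniform_in_s :
    ¬ ∃ N : ℕ, ∀ s : ℝ, 0 < s → ∀ n : ℕ, N ≤ n →
      (n : ℝ) ^ (-s) ≤ blockProb 3 (criticalProbI 3) n := by
  rintro ⟨N, hN⟩
  set n : ℕ := N + 1 with hn
  set b : ℝ := blockProb 3 (criticalProbI 3) n with hbdef
  have hb : b < 1 := blockProb_criticalProb_three_lt_one n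
  have h1b : 0 < 1 - b := by linarith
  have hn0 : (0 : ℝ) < n := by rw [hn]; positivity
  have hn1 : (1 : ℝ) ≤ n := by rw [hn]; exact_mod_cast Nat.succ_le_succ (Nat.zero_le N)
  have hlog : 0 ≤ Real.log n := Real.log_nonneg hn1
  set s : ℝ := (1 - b) / (2 * (Real.log n + 1)) with hs
  have hs0 : 0 < s := div_pos h1b (by positivity)
  have key := hN s hs0 n (Nat.le_succ N)
  have h1 : 1 - s * Real.log n ≤ (n : ℝ) ^ (-s) := by
    rw [Real.rpow_def_of_pos hn0]
    have := Real.add_one_le_exp (Real.log n * (-s))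
    linarith
  have h2 : s * Real.log n < 1 - b := by
    have e : s * (Real.log n + 1) = (1 - b) / 2 := by
      rw [hs]; field_simp
    nlinarith
  have : (n : ℝ) ^ (-s) ≤ b := key
  linarith

/-- **Refuted strengthening 2 (the endpoint `s = 0`)**: `u_n ≥ n^{0} = 1` eventually is FALSE. -/
theorem not_exponent_zero :
    ¬ ∀ᶠ n : ℕ in atTop, (n : ℝ) ^ (-(0 : ℝ)) ≤ blockProb 3 (criticalProbI 3) n := by
  intro h
  rw [eventually_atTop] at h
  obtain ⟨N, hN⟩ := h
  have := hN N le_rfl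
  rw [neg_zero, Real.rpow_zero] at this
  linarith [blockProb_criticalProb_three_lt_one N]

/-- **Refuted strengthening 3 (no eventuality)**: `∀ s > 0, ∀ n ≥ 1, n^{-s} ≤ u_n` is FALSE
(at `n = 1`, `1^{-s} = 1 > u_1`). -/
theorem not_forall_n :
    ¬ ∀ s : ℝ, 0 < s → ∀ n : ℕ, 1 ≤ n → (n : ℝ) ^ (-s) ≤ blockProb 3 (criticalProbI 3) n := by
  intro h
  have := h 1 one_pos 1 le_rfl
  rw [Nat.cast_one, Real.one_rpow] at this
  linarith [blockProb_criticalProb_three_lt_one 1]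

/-! ## §7 What IS known unconditionally: only the surface-order floor `(1-p)^{|∂_E Λ_n|} ≤ u_n` -/

/-- If every edge of the edge boundary of `Λ_n` is closed (`n ≥ 1`, lattice configuration), the
annulus is blocked: an open path from `Λ_n` to `∂ⁱⁿΛ_{2n} ∌ Λ_n` must leave `Λ_n` through `∂_E Λ_n`. -/
theorem not_mem_annulusCrossing_of_forall_notMem {d n : ℕ} (hn : 1 ≤ n) {ω : BondConfig (Site d)}
    (hω : ω ⊆ (zdGraph d).edgeSet) (h : ∀ e ∈ edgeBoundary (zdGraph d) (box d n), e ∉ ω) :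
    ω ∈ (annulusCrossing d n)ᶜ := by
  rintro ⟨x, hx, w, hw, hxw⟩
  have hpath := mem_openConnIn_iff_pathIn.1 hxw
  have hwn : w ∉ box d n := notMem_box_of_mem_innerBoundary_box (by omega) hw
  obtain ⟨a, b, ha, hb, -, hab, -⟩ := hpath.exit (R := (↑(box d n) : Set (Site d)))
    (Finset.mem_coe.2 hx) (fun h' => hwn (Finset.mem_coe.1 h'))
  have he : s(a, b) ∈ ω := ((openGraph_adj ω a b).1 hab).1
  refine h _ ?_ he
  rw [mem_edgeBoundary_iff]
  exact ⟨hω he, ⟨a, Finset.mem_coe.1 ha, Sym2.mem_mk_left _ _⟩,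
    ⟨b, fun hb' => hb (Finset.mem_coe.2 hb'), Sym2.mem_mk_right _ _⟩⟩

/-- **The trivial floor** (all that is known in `d = 3` at `p_c`): for `n ≥ 1`,
`(1 - p)^{|∂_E Λ_n|} ≤ u_n(d, p)`, with `|∂_E Λ_n| = O(n^{d-1})`
(`Literature.Probability.LatticeModels.tendsto_card_edgeBoundary_box_div`), i.e. `u_n ≥ e^{-C n²}` on `ℤ³` — to be
compared with the crux's `n^{-s}`. Nothing between `e^{-Cn²}` and `n^{-s}` is in print. -/
theorem pow_card_edgeBoundary_le_blockProb {d n : ℕ} (hn : 1 ≤ n) (p : unitInterval) :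
    (1 - (p : ℝ)) ^ (edgeBoundary (zdGraph d) (box d n)).card ≤ blockProb d p n :=
  (le_bondPercolation_real_forall_notMem (zdGraph d) p _).trans
    (real_mono_of_forall_subset_edgeSet (zdGraph d) p fun _ hω h =>
      not_mem_annulusCrossing_of_forall_notMem hn hω h)

/-- The floor is positive at `p_c(ℤ³) < 1`: `0 < u_n` for `n ≥ 1` (and `u_n < 1`, §6). -/
theorem blockProb_criticalProb_three_pos {n : ℕ} (hn : 1 ≤ n) : 0 < blockProb 3 (criticalProbI 3) n := by
  refine lt_of_lt_of_le (pow_pos ?_ _) (pow_card_edgeBoundary_le_blockProb hn (criticalProbI 3))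
  have : ((criticalProbI 3 : unitInterval) : ℝ) < 1 := criticalProb_zd_lt_one (by norm_num)
  linarith


end Summit.CriticalPhenomena.PercolationContinuityZ3.Theorems.SubpolynomialBlocking.Negative
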